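import Literature.AlgebraicGeometry.Resolution.StrictNormalCrossingsHasSNC
import Literature.AlgebraicGeometry.Resolution.BlowupRelativeDimension
import Literature.AlgebraicGeometry.Resolution.CoefficientIdealRestriction
import Literature.AlgebraicGeometry.Resolution.RegularLocalRingsQuotient
import Literature.AlgebraicGeometry.Resolution.RsopMonomialIdeals
import HarnessLib

/-!
# Crux `PatchingRelPerfect` (stmt-ResolutionOfSingularities-16161), chain W5.2 — T6-E1b residual `LegalScopedDivisorReduction₃`,
# PHASE 2 closer (2b), spec D4 step (i): THE IDEAL OF A HOST CURVE IS A TWO-PARAMETER IDEAL `(z, u)`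

[OURS · L1 W5.2 · res-L1-w52-lead-1 g5, hand #3b; spec `L/res-L1-w52-lead-1/PHASE2-STEPB-SPEC.md` §D4 ORACLE PLAN, step (i)]
Replaces the role of NO printed item; NOT a statement of the manuscript under review; fact-free.

For the host hypersurface `ι : X = V(D) ↪ E` (`D_{ιx} = (z)`, `z ∉ 𝔪²`, regular ambient stalk) and points `ζ ⤳ x` of `X` such that the
reduced curve `cl{ζ} ⊂ X` is cut out at `x` by ONE regular parameter `ū ∉ 𝔪_X²` (a component of a strict normal crossings divisor
of `X` through `x`), the ideal of `cl{ι ζ} ⊂ E` at `ι x` is `(z, u)` for any lift `u` of `ū`, and `(z, u)` is part of a regular system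
of parameters of `𝒪_{E,ιx}` (`𝒪_{E,ιx}/(z,u) ≅ 𝒪_{X,x}/(ū)` is regular of dimension `dim 𝒪_{E,ιx} − 2`, Matsumura 14.2).  This is the
input `I = (w₀, w₁)` of the generator-exchange lemma L3 (…DepthLegalRspExchange) in the cases (a)/(c) of the curve-choosing oracle.

AI-written; AI review is weaker than expert review.

## References
* H. Matsumura, *Commutative Ring Theory* (1986), Thm. 14.2. [Matsumura1987]
* The Stacks Project, Tag 01J7. [StacksProject]
-/

-- `Summit.<Summit>.<Sub>.Theorems` with `Sub = Summit` (single-conjunct summit, D-0017)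
set_option linter.dupNamespace false

noncomputable section

open CategoryTheory CategoryTheory.Limits AlgebraicGeometry TopologicalSpace IsLocalRing
open Literature.AlgebraicGeometry.Resolution Scheme.IdealSheafData

namespace Summit.ResolutionOfSingularities.ResolutionOfSingularities.Theorems

universe u

namespace DepthLegal

/-- [OURS · L1 W5.2] **Step (i): the ideal of a host curve at a point is the two-parameter ideal `(z, u)`** (module docstring).
[cite: Matsumura1987, Thm. 14.2] [cite: StacksProject, Tag 01J7] -/
theorem exists_isRsopPart_vanishingIdeal_closure_map {E : Scheme.{u}} {D : E.IdealSheafData} (x : D.subscheme)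
    [IsRegularLocalRing (E.presheaf.stalk (D.subschemeι x))] {z : E.presheaf.stalk (D.subschemeι x)}
    (hDx : stalkIdeal D (D.subschemeι x) = Ideal.span {z}) (hz2 : z ∉ maximalIdeal (E.presheaf.stalk (D.subschemeι x)) ^ 2)
    {ζ : D.subscheme} (hζx : ζ ⤳ x) {ubar : D.subscheme.presheaf.stalk x}
    (hC : stalkIdeal (vanishingIdeal ⟨closure {ζ}, isClosed_closure⟩ : D.subscheme.IdealSheafData) x = Ideal.span {ubar})
    (hubar : ubar ∉ maximalIdeal (D.subscheme.presheaf.stalk x) ^ 2) :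
    ∃ w : Fin 2 → E.presheaf.stalk (D.subschemeι x), IsRsopPart w ∧ w 0 = z ∧ (D.subschemeι.stalkMap x).hom (w 1) = ubar ∧
      stalkIdeal (vanishingIdeal ⟨closure {D.subschemeι ζ}, isClosed_closure⟩ : E.IdealSheafData) (D.subschemeι x) =
        Ideal.span (Set.range w) := by
  have hsurj : Function.Surjective (D.subschemeι.stalkMap x).hom := D.subschemeι.stalkMap_surjective x
  have hker : RingHom.ker (D.subschemeι.stalkMap x).hom = Ideal.span {z} := by rw [ker_stalkMap_subschemeι, hDx]
  have hzm : z ∈ maximalIdeal (E.presheaf.stalk (D.subschemeι x)) :=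
    (Ideal.span_singleton_le_iff_mem _).mp (hDx ▸ (mem_support_iff_stalkIdeal_le D _).mp (subschemeι_apply_mem_support D x))
  -- the host stalk is regular
  let e : (E.presheaf.stalk (D.subschemeι x) ⧸ Ideal.span {z}) ≃+* D.subscheme.presheaf.stalk x :=
    (Ideal.quotEquivOfEq hker.symm).trans (RingHom.quotientKerEquivOfSurjective hsurj)
  have hq := IsRegularLocalRing.quotient_span_singleton hzm hz2
  haveI : IsRegularLocalRing (D.subscheme.presheaf.stalk x) := by
    haveI := hq.1; exact IsRegularLocalRing.of_ringEquiv e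
  -- `ū ∈ 𝔪_X`: `x` lies on the curve
  have hxC : x ∈ (vanishingIdeal ⟨closure {ζ}, isClosed_closure⟩ : D.subscheme.IdealSheafData).support :=
    mem_support_vanishingIdeal_closure_singleton_iff.mpr hζx
  have hubm : ubar ∈ maximalIdeal (D.subscheme.presheaf.stalk x) :=
    (Ideal.span_singleton_le_iff_mem _).mp (hC ▸ (mem_support_iff_stalkIdeal_le _ x).mp hxC)
  -- lift `ū`
  obtain ⟨u', hu'⟩ := hsurj ubar
  let w : Fin 2 → E.presheaf.stalk (D.subschemeι x) := ![z, u']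
  have hw0 : w 0 = z := rfl
  have hw1 : w 1 = u' := rfl
  have hrange : Set.range w = {z, u'} := by
    ext a
    simp only [Set.mem_range, Fin.exists_fin_two, hw0, hw1, Set.mem_insert_iff, Set.mem_singleton_iff, eq_comm]
  -- the stalk identity
  have hI : stalkIdeal (vanishingIdeal ⟨closure {D.subschemeι ζ}, isClosed_closure⟩ : E.IdealSheafData) (D.subschemeι x) =
      Ideal.span (Set.range w) := by
    rw [stalkIdeal_vanishingIdeal_closure_singleton (hζx.map D.subschemeι.continuous),
      ← comap_stalkMap_primeOfSpecializes D.subschemeι hζx, ← stalkIdeal_vanishingIdeal_closure_singleton hζx, hC, ← hu',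
      ← Set.image_singleton, ← Ideal.map_span, Ideal.comap_map_of_surjective _ hsurj, ← RingHom.ker_eq_comap_bot, hker, hrange,
      Ideal.span_insert, sup_comm]
  -- `(z, u)` is part of a regular system of parameters
  have hψ : Function.Surjective ((Ideal.Quotient.mk (Ideal.span {ubar})).comp (D.subschemeι.stalkMap x).hom) :=
    Ideal.Quotient.mk_surjective.comp hsurj
  have hkerψ : RingHom.ker ((Ideal.Quotient.mk (Ideal.span {ubar})).comp (D.subschemeι.stalkMap x).hom) =
      Ideal.span (Set.range w) := by
    rw [← RingHom.comap_ker, Ideal.mk_ker, ← hu', ← Set.image_singleton, ← Ideal.map_span,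
      Ideal.comap_map_of_surjective _ hsurj, ← RingHom.ker_eq_comap_bot, hker, hrange, Ideal.span_insert, sup_comm]
  let e' : (E.presheaf.stalk (D.subschemeι x) ⧸ Ideal.span (Set.range w)) ≃+* (D.subscheme.presheaf.stalk x ⧸ Ideal.span {ubar}) :=
    (Ideal.quotEquivOfEq hkerψ.symm).trans (RingHom.quotientKerEquivOfSurjective hψ)
  have hq' := IsRegularLocalRing.quotient_span_singleton hubm hubar
  haveI : IsRegularLocalRing (E.presheaf.stalk (D.subschemeι x) ⧸ Ideal.span (Set.range w)) := by
    haveI := hq'.1; exact IsRegularLocalRing.of_ringEquiv e'.symm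
  have hwm : ∀ i, w i ∈ maximalIdeal (E.presheaf.stalk (D.subschemeι x)) := by
    intro i
    fin_cases i
    · exact hzm
    · change u' ∈ _
      by_contra hnot
      have hu : IsUnit u' := by
        by_contra hnu
        exact hnot ((mem_maximalIdeal _).mpr hnu)
      exact (mem_maximalIdeal _).mp hubm (hu' ▸ hu.map _)
  have hdim : ringKrullDim (E.presheaf.stalk (D.subschemeι x) ⧸ Ideal.span (Set.range w)) + (2 : ℕ) ≤
      ringKrullDim (E.presheaf.stalk (D.subschemeι x)) := by
    rw [ringKrullDim_eq_of_ringEquiv e', ← hq.2, ringKrullDim_eq_of_ringEquiv e, ← hq'.2, add_assoc]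
    exact le_of_eq (by norm_num)
  exact ⟨w, IsRsopPart.of_isRegularLocalRing_quotient hwm hdim, hw0, hu', hI⟩

end DepthLegal

end Summit.ResolutionOfSingularities.ResolutionOfSingularities.Theorems
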